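import Literature.Analysis.FluidPDE.FlatSwirlGaugeRelabel
import Literature.Analysis.FluidPDE.WholeSpaceIBP
import Summits.NavierStokesRegularity.NavierStokesRegularity.Theses.AxisymmetricExtremality
import HarnessLib

/-!
# Seregin 2020, Lemma 2.2 (after Nazarov–Uraltseva 2012): the convex excision profile and the
# Laplacian of products / compositions / finite sums

Helper toward the stub `stub_seregin2020TypeII` of the crux `AxisymmetricKatoGlobal` (= the named
fact `Literature.Analysis.FluidPDE.Seregin2020_axisymmetricSingularPoint_typeII`, G. Seregin,
Anal. Math. Phys. 10 (2020) Paper 46 = arXiv:2006.04140, Thm 2.1), reduced in the tree to the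
corrected Lemma 2.2 (`hWH′` of `blowupIndex_eq_top_of_weakHarnack'`; Nazarov–Uraltseva 2012,
Lemma 4.2 for the class 𝒱). In the class 𝒱 the function `Φ` is singular on a closed
`𝒫¹`-null set `S` of the axis, and every test function of the very weak form (4.5) (the tree's
`veryWeak_supersolution_axis_lowerBound`) must vanish near `S`. The excision is done with
test functions `η · G(∑ᵢ ψᵢ)`, `ψᵢ` parabolic bumps covering `S ∩ tsupport η`, where the profile
`G(s) = e² · expNegInvGlue((1-s)/2)` (`= exp(2 - 2/(1-s))` for `s < 1`, `= 0` for `s ≥ 1`) is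
smooth, nonincreasing, `G(0) = 1`, and CONVEX on `[0, ∞)`: convexity gives the one-sided
pointwise bound `Δ(G ∘ σ) ≥ G'(σ) Δσ`, so that in `-∫∫ Φ Δ(η G(σ))` (with `Φ, η ≥ 0`) only FIRST
powers of `∑ᵢ |Δψᵢ|, ∑ᵢ ‖∇ψᵢ‖` appear and no multiplicity bound on the cover is needed. This file:

* `exciseProfile_props` — smoothness, `G 0 = 1`, `G = 0` on `[1, ∞)`, `0 ≤ G ≤ 1` and `G' ≤ 0`,
  `G'' ≥ 0` on `[0, ∞)`, and a bound `|G'| ≤ C_G`;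
* `laplacian_mul_eq` / `laplacian_mul_ge` — `Δ(fg) = fΔg + gΔf + 2∑ᵢ∂ᵢf∂ᵢg` for `C²` functions
  on `(EuclideanSpace ℝ (Fin 3))` and the resulting bound `Δ(fg) ≥ fΔg + gΔf - 6‖Df‖‖Dg‖`;
* `laplacian_finset_sum` — `Δ(∑ᵢ ψᵢ) = ∑ᵢ Δψᵢ`;
* `deriv_comp_mul_laplacian_le` — `G'(σ x) Δσ(x) ≤ Δ(G ∘ σ)(x)` for `σ ≥ 0`... stated for any
  profile with `G'' ≥ 0` at `σ x` (chain rule `laplacian_comp_deriv_of_contDiffAt`).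

## References

* G. Seregin, Anal. Math. Phys. 10 (2020), Paper 46 = arXiv:2006.04140, Lemma 2.2, class 𝒱 (i)
  (arXiv p. 8). [Seregin2020]
* A. I. Nazarov, N. N. Uraltseva, St. Petersburg Math. J. 23 (2012) 93–115 = arXiv:1011.1888,
  §4, (4.5)–(4.6). [NazarovUraltseva2012]
-/

-- the problem directory repeats the summit name (D-0017); core's `dupNamespace` linter fires
set_option linter.dupNamespace false

noncomputable section

open MeasureTheory Set Function Filter Topology TopologicalSpace Metric
open scoped NNReal ENNReal InnerProductSpace Laplacian

namespace Summit.NavierStokesRegularity.NavierStokesRegularity.Theorems.AxisymmetricKatoGlobal.EulerScaling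

open Literature.Analysis.FluidPDE

/-! ### The glue `x ↦ exp(-1/x)`: first two derivatives on `x > 0` -/

/-- On `x > 0`, `expNegInvGlue` has derivative `exp(-1/x) · (x²)⁻¹`. [folklore] -/
theorem hasDerivAt_expNegInvGlue_of_pos {x : ℝ} (hx : 0 < x) :
    HasDerivAt expNegInvGlue (Real.exp (-x⁻¹) * (x ^ 2)⁻¹) x := by
  have hev : expNegInvGlue =ᶠ[𝓝 x] fun y => Real.exp (-y⁻¹) := by
    filter_upwards [isOpen_Ioi.mem_nhds hx] with y hy
    simp [expNegInvGlue, not_le.2 (mem_Ioi.1 hy)]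
  have h : HasDerivAt (fun y : ℝ => Real.exp (-y⁻¹)) (Real.exp (-x⁻¹) * (x ^ 2)⁻¹) x := by
    have h1 : HasDerivAt (fun y : ℝ => -y⁻¹) ((x ^ 2)⁻¹) x :=
      (hasDerivAt_inv hx.ne').fun_neg.congr_deriv (neg_neg _)
    exact h1.exp
  exact h.congr_of_eventuallyEq hev

/-- On `x > 0`, `(expNegInvGlue)'` has derivative `exp(-1/x) · (x⁴)⁻¹ · (1 - 2x)`, which is
nonnegative for `x ≤ 1/2`. [folklore] -/
theorem hasDerivAt_deriv_expNegInvGlue_of_pos {x : ℝ} (hx : 0 < x) :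
    HasDerivAt (deriv expNegInvGlue) (Real.exp (-x⁻¹) * (x ^ 4)⁻¹ * (1 - 2 * x)) x := by
  have hev : deriv expNegInvGlue =ᶠ[𝓝 x] fun y => Real.exp (-y⁻¹) * (y ^ 2)⁻¹ := by
    filter_upwards [isOpen_Ioi.mem_nhds hx] with y hy
    exact (hasDerivAt_expNegInvGlue_of_pos (mem_Ioi.1 hy)).deriv
  have h1 : HasDerivAt (fun y : ℝ => -y⁻¹) ((x ^ 2)⁻¹) x :=
    (hasDerivAt_inv hx.ne').fun_neg.congr_deriv (neg_neg _)
  have h2 : HasDerivAt (fun y : ℝ => Real.exp (-y⁻¹)) (Real.exp (-x⁻¹) * (x ^ 2)⁻¹) x := h1.exp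
  have h3 : HasDerivAt (fun y : ℝ => (y ^ 2)⁻¹) (-(2 * x) / (x ^ 2) ^ 2) x :=
    ((hasDerivAt_pow 2 x).fun_inv (pow_ne_zero 2 hx.ne')).congr_deriv (by norm_num)
  have h := h2.mul h3
  refine (h.congr_of_eventuallyEq hev).congr_deriv ?_
  field_simp
  ring

/-- `(expNegInvGlue)'' ≥ 0` on `]-∞, 1/2]` (explicit on `]0, 1/2]`, zero on `]-∞, 0[`, and at `0`
by continuity of the second derivative of the smooth glue). [folklore] -/
theorem deriv_deriv_expNegInvGlue_nonneg {x : ℝ} (hx : x ≤ 1 / 2) : 0 ≤ deriv (deriv expNegInvGlue) x := by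
  -- the set where the continuous second derivative is nonnegative is closed
  have hcont : Continuous (deriv (deriv expNegInvGlue)) := by
    have h2 : ContDiff ℝ (1 + 1) expNegInvGlue := expNegInvGlue.contDiff
    exact h2.deriv'.continuous_deriv le_rfl
  have hpos : ∀ y : ℝ, 0 < y → y ≤ 1 / 2 → 0 ≤ deriv (deriv expNegInvGlue) y := by
    intro y hy hy2
    rw [(hasDerivAt_deriv_expNegInvGlue_of_pos hy).deriv]
    have : 0 ≤ 1 - 2 * y := by linarith
    positivity
  have hneg : ∀ y : ℝ, y < 0 → deriv (deriv expNegInvGlue) y = 0 := by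
    intro y hy
    have hev : deriv expNegInvGlue =ᶠ[𝓝 y] fun _ => 0 := by
      have hev0 : expNegInvGlue =ᶠ[𝓝 y] fun _ => 0 := by
        filter_upwards [isOpen_Iio.mem_nhds hy] with w hw
        exact expNegInvGlue.zero_of_nonpos (le_of_lt hw)
      filter_upwards [hev0.eventuallyEq_nhds] with w hw
      rw [hw.deriv_eq, deriv_const]
    rw [hev.deriv_eq, deriv_const]
  rcases lt_trichotomy x 0 with h | h | h
  · exact (hneg x h).symm.le
  · -- `x = 0`: limit from the left of the zero second derivative
    subst h
    have hclosed : IsClosed {y : ℝ | 0 ≤ deriv (deriv expNegInvGlue) y} :=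
      isClosed_le continuous_const hcont
    have hmem : (0 : ℝ) ∈ closure (Iio (0 : ℝ)) := by
      rw [closure_Iio]; exact self_mem_Iic
    exact closure_minimal (fun y hy => (hneg y hy).symm.le) hclosed hmem
  · exact hpos x h hx

/-! ### The excision profile `G(s) = e² · expNegInvGlue((1 - s)/2)` -/

/-- **The convex excision profile.** For `G(s) = e² · expNegInvGlue((1-s)/2)`: `G` is smooth,
`G 0 = 1`, `G s = 0` for `1 ≤ s`, `0 ≤ G s`, and for `0 ≤ s`: `G s ≤ 1`, `G' s ≤ 0`, `G'' s ≥ 0`;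
moreover `|G' s| ≤ C` for all `s ≥ 0`, for some `C ≥ 0`. [folklore] -/
theorem exciseProfile_props {G : ℝ → ℝ} (hG : ∀ s, G s = Real.exp 2 * expNegInvGlue ((1 - s) / 2)) :
    ContDiff ℝ (⊤ : ℕ∞) G ∧ G 0 = 1 ∧ (∀ s, 1 ≤ s → G s = 0) ∧ (∀ s, 0 ≤ G s) ∧
    (∀ s, 0 ≤ s → G s ≤ 1) ∧ (∀ s, deriv G s ≤ 0) ∧ (∀ s, 0 ≤ s → 0 ≤ deriv (deriv G) s) ∧
    ∃ C : ℝ, 0 ≤ C ∧ ∀ s, 0 ≤ s → |deriv G s| ≤ C := by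
  have hGf : G = fun s => Real.exp 2 * expNegInvGlue ((1 - s) / 2) := funext hG
  have haff : ∀ s : ℝ, HasDerivAt (fun s : ℝ => (1 - s) / 2) (-(1 / 2 : ℝ)) s := fun s =>
    (((hasDerivAt_id' s).const_sub 1).div_const 2).congr_deriv (by ring)
  have hsmooth : ContDiff ℝ (⊤ : ℕ∞) G := by
    rw [hGf]
    exact contDiff_const.mul (expNegInvGlue.contDiff.comp
      ((contDiff_const.sub contDiff_id).div_const 2))
  have hG0 : G 0 = 1 := by
    rw [hG]
    have h1 : ((1 : ℝ) - 0) / 2 = 2⁻¹ := by norm_num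
    have h : expNegInvGlue ((1 - 0) / 2) = Real.exp (-2) := by
      rw [h1]
      simp [expNegInvGlue, not_le.2 (by norm_num : (0 : ℝ) < 2⁻¹)]
    rw [h, ← Real.exp_add]; norm_num
  have hG1 : ∀ s, 1 ≤ s → G s = 0 := fun s hs => by
    rw [hG, expNegInvGlue.zero_of_nonpos (by linarith), mul_zero]
  have hGnn : ∀ s, 0 ≤ G s := fun s => by
    rw [hG]; exact mul_nonneg (Real.exp_pos 2).le (expNegInvGlue.nonneg _)
  have hanti : Antitone G := fun a b hab => by
    rw [hG, hG]
    exact mul_le_mul_of_nonneg_left (expNegInvGlue.monotone (by linarith)) (Real.exp_pos 2).le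
  have hGle : ∀ s, 0 ≤ s → G s ≤ 1 := fun s hs => hG0 ▸ hanti hs
  -- the derivative: chain rule through the affine map
  have hderiv : ∀ s, HasDerivAt G (Real.exp 2 * (deriv expNegInvGlue ((1 - s) / 2) * (-(1 / 2 : ℝ)))) s := by
    intro s
    rw [hGf]
    have hd : DifferentiableAt ℝ expNegInvGlue ((1 - s) / 2) :=
      (expNegInvGlue.contDiff (n := 1)).differentiable one_ne_zero _
    exact (hd.hasDerivAt.comp s (haff s)).const_mul _
  have hderiv_eq : deriv G = fun s => Real.exp 2 * (deriv expNegInvGlue ((1 - s) / 2) * (-(1 / 2 : ℝ))) :=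
    funext fun s => (hderiv s).deriv
  have hGd : ∀ s, deriv G s ≤ 0 := fun s => hanti.deriv_nonpos
  -- the second derivative
  have hderiv2 : ∀ s, deriv (deriv G) s = Real.exp 2 * (1 / 4) * deriv (deriv expNegInvGlue) ((1 - s) / 2) := by
    intro s
    rw [hderiv_eq]
    have hd : DifferentiableAt ℝ (deriv expNegInvGlue) ((1 - s) / 2) := by
      have h2 : ContDiff ℝ (1 + 1) expNegInvGlue := expNegInvGlue.contDiff
      exact (h2.deriv'.differentiable one_ne_zero) _
    have h : HasDerivAt (fun y : ℝ => Real.exp 2 * (deriv expNegInvGlue ((1 - y) / 2) * (-(1 / 2 : ℝ))))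
        (Real.exp 2 * (deriv (deriv expNegInvGlue) ((1 - s) / 2) * (-(1 / 2 : ℝ)) * (-(1 / 2 : ℝ)))) s :=
      ((hd.hasDerivAt.comp s (haff s)).mul_const (-(1 / 2 : ℝ))).const_mul (Real.exp 2)
    rw [h.deriv]; ring
  have hGdd : ∀ s, 0 ≤ s → 0 ≤ deriv (deriv G) s := fun s hs => by
    rw [hderiv2 s]
    exact mul_nonneg (by positivity) (deriv_deriv_expNegInvGlue_nonneg (by linarith))
  -- a bound for `|G'|` on `[0, ∞)`: compactness on `[0, 1]`, and `G' = 0` on `[1, ∞)`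
  have hcontd : Continuous (deriv G) := hsmooth.continuous_deriv (by simp)
  have hG'1 : ∀ s, 1 ≤ s → deriv G s = 0 := by
    intro s hs
    -- `G ≥ 0` vanishes on `[1, ∞)`, so every such point is a minimum of `G`
    have hmin : IsLocalMin G s := by
      filter_upwards with y
      rw [hG1 s hs]
      exact hGnn y
    exact hmin.deriv_eq_zero
  obtain ⟨C, hC⟩ := isCompact_Icc.exists_bound_of_continuousOn (s := Icc (0 : ℝ) 1) hcontd.continuousOn
  refine ⟨hsmooth, hG0, hG1, hGnn, hGle, hGd, hGdd, max C 0, le_max_right _ _, fun s hs => ?_⟩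
  rcases le_or_gt s 1 with h | h
  · exact ((Real.norm_eq_abs _).symm.le.trans (hC s ⟨hs, h⟩)).trans (le_max_left _ _)
  · rw [hG'1 s h.le, abs_zero]; exact le_max_right _ _

/-! ### Laplacian of products, finite sums and compositions -/

/-- **Hessian of a product** along a direction: `D²(fg)(x)(v,v) = f D²g(v,v) + 2 Df(v) Dg(v) + g D²f(v,v)`
for `C²` functions `f, g : (EuclideanSpace ℝ (Fin 3)) → ℝ`. [folklore] -/
theorem fderiv_fderiv_mul_apply' {f g : (EuclideanSpace ℝ (Fin 3)) → ℝ} (hf : ContDiff ℝ 2 f) (hg : ContDiff ℝ 2 g) (x v : (EuclideanSpace ℝ (Fin 3))) :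
    fderiv ℝ (fun y => fderiv ℝ (fun w => f w * g w) y v) x v =
      f x * fderiv ℝ (fun y => fderiv ℝ g y v) x v + 2 * (fderiv ℝ f x v * fderiv ℝ g x v) +
        g x * fderiv ℝ (fun y => fderiv ℝ f y v) x v := by
  -- adapted from Literature/Analysis/FluidPDE/ChaeEulerLiouville.lean (`fderiv_fderiv_mul_apply`)
  have hf1 : Differentiable ℝ f := hf.differentiable (by norm_num)
  have hg1 : Differentiable ℝ g := hg.differentiable (by norm_num)
  have hfv : Differentiable ℝ fun y => fderiv ℝ f y v :=
    ((hf.fderiv_right (m := 1) (by norm_num)).clm_apply contDiff_const).differentiable one_ne_zero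
  have hgv : Differentiable ℝ fun y => fderiv ℝ g y v :=
    ((hg.fderiv_right (m := 1) (by norm_num)).clm_apply contDiff_const).differentiable one_ne_zero
  have h1 : (fun y => fderiv ℝ (fun w => f w * g w) y v) = fun y => f y * fderiv ℝ g y v + g y * fderiv ℝ f y v := by
    funext y
    rw [fderiv_fun_mul (hf1 y) (hg1 y)]
    simp only [_root_.add_apply, FunLike.coe_smul, Pi.smul_apply, smul_eq_mul]
  rw [h1]
  have hA : DifferentiableAt ℝ (fun y => f y * fderiv ℝ g y v) x := (hf1 x).mul (hgv x)
  have hB : DifferentiableAt ℝ (fun y => g y * fderiv ℝ f y v) x := (hg1 x).mul (hfv x)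
  rw [fderiv_fun_add hA hB, fderiv_fun_mul (hf1 x) (hgv x), fderiv_fun_mul (hg1 x) (hfv x)]
  simp only [_root_.add_apply, FunLike.coe_smul, Pi.smul_apply, smul_eq_mul]
  ring

/-- **Laplacian of a product** of `C²` functions on `(EuclideanSpace ℝ (Fin 3))`:
`Δ(fg) = f Δg + 2 ∑ᵢ ∂ᵢf ∂ᵢg + g Δf`. [folklore] -/
theorem laplacian_mul_eq {f g : (EuclideanSpace ℝ (Fin 3)) → ℝ} (hf : ContDiff ℝ 2 f) (hg : ContDiff ℝ 2 g) (x : (EuclideanSpace ℝ (Fin 3))) :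
    (Δ (fun w => f w * g w)) x = f x * (Δ g) x +
      2 * ∑ i, fderiv ℝ f x (stdOrthonormalBasis ℝ (EuclideanSpace ℝ (Fin 3)) i) * fderiv ℝ g x (stdOrthonormalBasis ℝ (EuclideanSpace ℝ (Fin 3)) i) +
        g x * (Δ f) x := by
  set b := stdOrthonormalBasis ℝ (EuclideanSpace ℝ (Fin 3))
  have hfg : ContDiff ℝ 2 fun w => f w * g w := hf.mul hg
  rw [laplacian_eq_sum_fderiv_fderiv b hfg, laplacian_eq_sum_fderiv_fderiv b hf,
    laplacian_eq_sum_fderiv_fderiv b hg]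
  simp only [fderiv_fderiv_mul_apply' hf hg, Finset.sum_add_distrib, Finset.mul_sum]

/-- **One-sided product bound**: `Δ(fg)(x) ≥ f Δg + g Δf - 2·3·‖Df‖‖Dg‖` on `(EuclideanSpace ℝ (Fin 3))`
(`|∑ᵢ ∂ᵢf ∂ᵢg| ≤ 3‖Df‖‖Dg‖`). [folklore] -/
theorem laplacian_mul_ge {f g : (EuclideanSpace ℝ (Fin 3)) → ℝ} (hf : ContDiff ℝ 2 f) (hg : ContDiff ℝ 2 g) (x : (EuclideanSpace ℝ (Fin 3))) :
    f x * (Δ g) x + g x * (Δ f) x - 6 * (‖fderiv ℝ f x‖ * ‖fderiv ℝ g x‖) ≤ (Δ (fun w => f w * g w)) x := by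
  rw [laplacian_mul_eq hf hg]
  set b := stdOrthonormalBasis ℝ (EuclideanSpace ℝ (Fin 3))
  have hterm : ∀ i, -(‖fderiv ℝ f x‖ * ‖fderiv ℝ g x‖) ≤ fderiv ℝ f x (b i) * fderiv ℝ g x (b i) := by
    intro i
    have h1 : |fderiv ℝ f x (b i)| ≤ ‖fderiv ℝ f x‖ := by
      have := (fderiv ℝ f x).le_opNorm (b i)
      rw [b.orthonormal.1 i, mul_one, Real.norm_eq_abs] at this
      exact this
    have h2 : |fderiv ℝ g x (b i)| ≤ ‖fderiv ℝ g x‖ := by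
      have := (fderiv ℝ g x).le_opNorm (b i)
      rw [b.orthonormal.1 i, mul_one, Real.norm_eq_abs] at this
      exact this
    have h := mul_le_mul h1 h2 (abs_nonneg _) (norm_nonneg _)
    rw [← abs_mul] at h
    exact neg_le_of_abs_le h
  have hsum : -(3 * (‖fderiv ℝ f x‖ * ‖fderiv ℝ g x‖)) ≤ ∑ i, fderiv ℝ f x (b i) * fderiv ℝ g x (b i) := by
    have h := Finset.sum_le_sum fun i (_ : i ∈ Finset.univ) => hterm i
    simp only [Finset.sum_const, Finset.card_univ] at h
    have hcard : (Fintype.card (Fin (Module.finrank ℝ (EuclideanSpace ℝ (Fin 3)))) : ℝ) = 3 := by simp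
    rw [nsmul_eq_mul] at h
    simpa [hcard] using h
  linarith

/-- **Laplacian of a finite sum** of `C²` functions: `Δ(∑ᵢ ψᵢ) = ∑ᵢ Δψᵢ`. [folklore] -/
theorem laplacian_finset_sum {ι : Type*} (s : Finset ι) {ψ : ι → (EuclideanSpace ℝ (Fin 3)) → ℝ} (hψ : ∀ i ∈ s, ContDiff ℝ 2 (ψ i))
    (x : (EuclideanSpace ℝ (Fin 3))) : (Δ (fun w => ∑ i ∈ s, ψ i w)) x = ∑ i ∈ s, (Δ (ψ i)) x := by
  classical
  induction s using Finset.induction_on with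
  | empty =>
    simp only [Finset.sum_empty]
    exact laplacian_eq_zero_of_notMem_tsupport (by simp)
  | @insert a s ha ih =>
    have hψa : ContDiff ℝ 2 (ψ a) := hψ a (Finset.mem_insert_self a s)
    have hψs : ∀ i ∈ s, ContDiff ℝ 2 (ψ i) := fun i hi => hψ i (Finset.mem_insert_of_mem hi)
    have hsum : ContDiff ℝ 2 fun w => ∑ i ∈ s, ψ i w := ContDiff.sum fun i hi => hψs i hi
    simp only [Finset.sum_insert ha]
    have h := (hψa.contDiffAt (x := x)).laplacian_add (hsum.contDiffAt (x := x))
    have e : (fun w => ψ a w + ∑ i ∈ s, ψ i w) = (ψ a + fun w => ∑ i ∈ s, ψ i w) := rfl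
    rw [e, h, ih hψs]

/-- **Convex profiles lose only the first-order term under the Laplacian**: if `G'' (σ x) ≥ 0`
then `G'(σ x) Δσ(x) ≤ Δ(G ∘ σ)(x)` (chain rule `Δ(G∘σ) = G''(σ)‖∇σ‖² + G'(σ)Δσ`). [folklore] -/
theorem deriv_mul_laplacian_le_laplacian_comp {σ : (EuclideanSpace ℝ (Fin 3)) → ℝ} {G : ℝ → ℝ} {x : (EuclideanSpace ℝ (Fin 3))}
    (hσ : ContDiffAt ℝ 2 σ x) (hG : ContDiffAt ℝ 2 G (σ x)) (hG2 : 0 ≤ deriv (deriv G) (σ x)) :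
    deriv G (σ x) * (Δ σ) x ≤ (Δ (fun y => G (σ y))) x := by
  rw [laplacian_comp_deriv_of_contDiffAt hσ hG]
  have : 0 ≤ deriv (deriv G) (σ x) * ‖gradient σ x‖ ^ 2 := mul_nonneg hG2 (sq_nonneg _)
  linarith

end Summit.NavierStokesRegularity.NavierStokesRegularity.Theorems.AxisymmetricKatoGlobal.EulerScaling

end
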